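import Summits.Langlands.Langlands.Theorems.RationalPeriodQuarterAnalyticCoreRigid

/-!
# `AnalyticCore` (child 2 of the lens-1-g38 split of `RationalPeriodQuarter.SemiAnalyticRigidity`) — the difference `Δh`

For `h := f - ρ` (tame at every real point) we study `k := Δh`, `k t = h (t+1) - h t`: it is again tame at every
point, it is analytic wherever `f, ρ` are analytic at `t` and `t+1`, and on each tail it is cofinitely ONE explicit
fraction (from the `T`-coboundary identity `Δf = q_T` and the tail pieces of `q_T` and `ρ`).  Also: reduction of a
fraction to one without common roots, in the form used downstream.
-/

set_option linter.dupNamespace false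

namespace Summit.Langlands.Langlands.Theorems

open Filter Set Topology Polynomial

/-- Reduce `P/Q` to a fraction without common root, keeping track of where it is defined. -/
theorem anCore_reduce (P Q : ℂ[X]) (hQ : Q ≠ 0) :
    ∃ P₁ Q₁ : ℂ[X], Q₁ ≠ 0 ∧ (∀ β : ℂ, ¬ (P₁.IsRoot β ∧ Q₁.IsRoot β)) ∧
      ∀ z : ℂ, Q.eval z ≠ 0 → Q₁.eval z ≠ 0 ∧ P.eval z / Q.eval z = P₁.eval z / Q₁.eval z := by
  obtain ⟨P₁, Q₁, hQ₁, hno, hPQ⟩ := ratDescent_remove_common_roots Q.natDegree P Q rfl hQ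
  refine ⟨P₁, Q₁, hQ₁, hno, fun z hz => ?_⟩
  have hcross : P.eval z * Q₁.eval z = P₁.eval z * Q.eval z := by
    have := congrArg (Polynomial.eval z) hPQ
    simpa [Polynomial.eval_mul] using this
  have hQ₁z : Q₁.eval z ≠ 0 := by
    intro h0
    have hP₁ : P₁.eval z = 0 := by
      have : P₁.eval z * Q.eval z = 0 := by rw [← hcross, h0, mul_zero]
      rcases mul_eq_zero.1 this with h | h
      · exact h
      · exact absurd h hz
    exact hno z ⟨hP₁, h0⟩
  refine ⟨hQ₁z, ?_⟩
  rw [div_eq_div_iff hz hQ₁z]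
  exact hcross

/-- Transport of a punctured-neighbourhood statement along `t ↦ t + 1`. -/
theorem anCore_transport_nhdsNE {p : ℝ → Prop} (x : ℝ) (h : ∀ᶠ (t : ℝ) in 𝓝[≠] (x + 1), p t) :
    ∀ᶠ (t : ℝ) in 𝓝[≠] x, p (t + 1) :=
  tameDecomp_eventually_nhdsNE
    ((tameDecomp_tendsto_add_one_nhdsLT x).eventually (h.filter_mono (nhdsLT_le_nhdsNE (x + 1))))
    ((tameDecomp_tendsto_add_one_nhdsGT x).eventually (h.filter_mono (nhdsGT_le_nhdsNE (x + 1))))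

/-- Shift of an analytic germ. -/
theorem anCore_analyticAt_shift (g : ℝ → ℂ) (x c : ℝ) (hg : AnalyticAt ℝ g (x + c)) :
    AnalyticAt ℝ (fun t : ℝ => g (t + c)) x := by
  have h1 : AnalyticAt ℝ (fun t : ℝ => t + c) x := analyticAt_id.add analyticAt_const
  have := AnalyticAt.comp (f := fun t : ℝ => t + c) (g := g) hg h1
  simpa [Function.comp_def] using this

/-- A shifted nonzero polynomial is nonzero. -/
theorem anCore_comp_X_add_one_ne_zero {Q : ℂ[X]} (hQ : Q ≠ 0) : Q.comp (X + 1) ≠ 0 := by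
  intro h
  apply hQ
  have : (Q.comp (X + 1)).comp (X - 1) = Q := by
    rw [Polynomial.comp_assoc]
    simp
  rw [← this, h, Polynomial.zero_comp]

/-- `Δ` of a tame function is tame (two-sided punctured version of tameness). -/
theorem anCore_tame_delta (h : ℝ → ℂ)
    (htame : ∀ x : ℝ, ∃ g : ℝ → ℂ, AnalyticAt ℝ g x ∧ ∃ P Q : ℂ[X], Q ≠ 0 ∧
      ∀ᶠ (t : ℝ) in 𝓝[≠] x, h t = g t + P.eval (t : ℂ) / Q.eval (t : ℂ)) (x : ℝ) :
    ∃ g : ℝ → ℂ, AnalyticAt ℝ g x ∧ ∃ P Q : ℂ[X], Q ≠ 0 ∧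
      ∀ᶠ (t : ℝ) in 𝓝[≠] x, h (t + 1) - h t = g t + P.eval (t : ℂ) / Q.eval (t : ℂ) := by
  obtain ⟨g₀, hg₀, P₀, Q₀, hQ₀, h₀⟩ := htame x
  obtain ⟨g₁, hg₁, P₁, Q₁, hQ₁, h₁⟩ := htame (x + 1)
  have h₁' := anCore_transport_nhdsNE x h₁
  have hQ₀ev := tameDecomp_eventually_nhdsNE_of_cofinite (tameDecomp_eventually_cofinite_eval_ne_zero hQ₀) x
  have hQ₁ev : ∀ᶠ (t : ℝ) in 𝓝[≠] x, (Q₁.comp (X + 1)).eval (t : ℂ) ≠ 0 :=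
    tameDecomp_eventually_nhdsNE_of_cofinite
      (tameDecomp_eventually_cofinite_eval_ne_zero (anCore_comp_X_add_one_ne_zero hQ₁)) x
  refine ⟨fun t => g₁ (t + 1) - g₀ t, (anCore_analyticAt_shift g₁ x 1 hg₁).sub hg₀,
    P₁.comp (X + 1) * Q₀ - P₀ * Q₁.comp (X + 1), Q₁.comp (X + 1) * Q₀,
    mul_ne_zero (anCore_comp_X_add_one_ne_zero hQ₁) hQ₀, ?_⟩
  filter_upwards [h₀, h₁', hQ₀ev, hQ₁ev] with t ht0 ht1 hq0 hq1
  have hq1' : Q₁.eval ((t : ℂ) + 1) ≠ 0 := by simpa [Polynomial.eval_comp] using hq1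
  rw [ht0, ht1]
  simp only [Polynomial.eval_mul, Polynomial.eval_sub, Polynomial.eval_comp, Polynomial.eval_add,
    Polynomial.eval_X, Polynomial.eval_one]
  push_cast
  field_simp
  ring

/-- `Δh` is analytic at `x` when `f, ρ` are analytic at `x` and `x + 1`. -/
theorem anCore_delta_analyticAt (f ρ : ℝ → ℂ) (x : ℝ) (hf0 : AnalyticAt ℝ f x) (hf1 : AnalyticAt ℝ f (x + 1))
    (hρ0 : AnalyticAt ℝ ρ x) (hρ1 : AnalyticAt ℝ ρ (x + 1)) :
    AnalyticAt ℝ (fun t : ℝ => (f (t + 1) - ρ (t + 1)) - (f t - ρ t)) x :=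
  ((anCore_analyticAt_shift f x 1 hf1).sub (anCore_analyticAt_shift ρ x 1 hρ1)).sub (hf0.sub hρ0)

/-- Right tail of `Δh` as ONE fraction, cofinitely. -/
theorem anCore_delta_tail_right (f ρ q : ℝ → ℂ) (hT : ∀ᶠ t in Filter.cofinite, f (t + 1) - f t = q t)
    (Bq : ℝ) (P' : ℂ[X]) (D' : ℚ[X])
    (hq : ∀ t : ℝ, Bq < t → aeval (t : ℂ) D' ≠ 0 ∧ q t = P'.eval (t : ℂ) / aeval (t : ℂ) D')
    (Bρ : ℝ) (Pr Qr : ℂ[X])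
    (hρ : ∀ t : ℝ, Bρ < t → Qr.eval (t : ℂ) ≠ 0 ∧ ρ t = Pr.eval (t : ℂ) / Qr.eval (t : ℂ)) :
    ∃ A₀ B₀ : ℂ[X], B₀ ≠ 0 ∧ ∃ R : ℝ, (∀ t : ℝ, R < t → B₀.eval (t : ℂ) ≠ 0) ∧
      ∀ᶠ t in Filter.cofinite, R < t →
        (f (t + 1) - ρ (t + 1)) - (f t - ρ t) = A₀.eval (t : ℂ) / B₀.eval (t : ℂ) := by
  set Dc : ℂ[X] := D'.map (algebraMap ℚ ℂ) with hDc
  have hDev : ∀ t : ℝ, aeval (t : ℂ) D' = Dc.eval (t : ℂ) := fun t => ratDescent_aeval_eq_eval_map D' _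
  have hR : ∀ t : ℝ, max Bq Bρ < t → Dc.eval (t : ℂ) ≠ 0 ∧ Qr.eval ((t : ℂ) + 1) ≠ 0 ∧
      Qr.eval (t : ℂ) ≠ 0 := by
    intro t ht
    have h1 := (hq t (lt_of_le_of_lt (le_max_left _ _) ht)).1
    have h2 := (hρ (t + 1) (by linarith [le_max_right Bq Bρ])).1
    have h3 := (hρ t (lt_of_le_of_lt (le_max_right _ _) ht)).1
    push_cast at h2
    exact ⟨by rwa [hDev] at h1, h2, h3⟩
  have hDc0 : Dc ≠ 0 := by
    intro h0
    have := (hR (max Bq Bρ + 1) (by linarith)).1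
    rw [h0, Polynomial.eval_zero] at this
    exact this rfl
  have hQr0 : Qr ≠ 0 := by
    intro h0
    have := (hR (max Bq Bρ + 1) (by linarith)).2.2
    rw [h0, Polynomial.eval_zero] at this
    exact this rfl
  refine ⟨P' * (Qr.comp (X + 1) * Qr) - (Pr.comp (X + 1) * Qr - Pr * Qr.comp (X + 1)) * Dc,
    Dc * (Qr.comp (X + 1) * Qr),
    mul_ne_zero hDc0 (mul_ne_zero (anCore_comp_X_add_one_ne_zero hQr0) hQr0), max Bq Bρ, ?_, ?_⟩
  · intro t ht
    obtain ⟨h1, h2, h3⟩ := hR t ht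
    simp only [Polynomial.eval_mul, Polynomial.eval_comp, Polynomial.eval_add, Polynomial.eval_X,
      Polynomial.eval_one]
    exact mul_ne_zero h1 (mul_ne_zero h2 h3)
  · filter_upwards [hT] with t ht hRt
    obtain ⟨h1, h2, h3⟩ := hR t hRt
    have hqt := (hq t (lt_of_le_of_lt (le_max_left _ _) hRt)).2
    have hρt := (hρ t (lt_of_le_of_lt (le_max_right _ _) hRt)).2
    have hρt1 := (hρ (t + 1) (by linarith [le_max_right Bq Bρ])).2
    push_cast at hρt1
    rw [hDev] at hqt
    have : (f (t + 1) - ρ (t + 1)) - (f t - ρ t) = q t - (ρ (t + 1) - ρ t) := by rw [← ht]; ring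
    rw [this, hqt, hρt, hρt1]
    simp only [Polynomial.eval_mul, Polynomial.eval_sub, Polynomial.eval_comp, Polynomial.eval_add,
      Polynomial.eval_X, Polynomial.eval_one]
    field_simp

/-- Left tail of `Δh` as ONE fraction, cofinitely. -/
theorem anCore_delta_tail_left (f ρ q : ℝ → ℂ) (hT : ∀ᶠ t in Filter.cofinite, f (t + 1) - f t = q t)
    (Bq : ℝ) (P' : ℂ[X]) (D' : ℚ[X])
    (hq : ∀ t : ℝ, t < -Bq → aeval (t : ℂ) D' ≠ 0 ∧ q t = P'.eval (t : ℂ) / aeval (t : ℂ) D')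
    (Bρ : ℝ) (Pr Qr : ℂ[X])
    (hρ : ∀ t : ℝ, t < -Bρ → Qr.eval (t : ℂ) ≠ 0 ∧ ρ t = Pr.eval (t : ℂ) / Qr.eval (t : ℂ)) :
    ∃ A₀ B₀ : ℂ[X], B₀ ≠ 0 ∧ ∃ R : ℝ, (∀ t : ℝ, t < -R → B₀.eval (t : ℂ) ≠ 0) ∧
      ∀ᶠ t in Filter.cofinite, t < -R →
        (f (t + 1) - ρ (t + 1)) - (f t - ρ t) = A₀.eval (t : ℂ) / B₀.eval (t : ℂ) := by
  set Dc : ℂ[X] := D'.map (algebraMap ℚ ℂ) with hDc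
  have hDev : ∀ t : ℝ, aeval (t : ℂ) D' = Dc.eval (t : ℂ) := fun t => ratDescent_aeval_eq_eval_map D' _
  have hR : ∀ t : ℝ, t < -(max Bq Bρ + 1) → Dc.eval (t : ℂ) ≠ 0 ∧ Qr.eval ((t : ℂ) + 1) ≠ 0 ∧
      Qr.eval (t : ℂ) ≠ 0 := by
    intro t ht
    have hm1 := le_max_left Bq Bρ
    have hm2 := le_max_right Bq Bρ
    have h1 := (hq t (by linarith)).1
    have h2 := (hρ (t + 1) (by linarith)).1
    have h3 := (hρ t (by linarith)).1
    push_cast at h2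
    exact ⟨by rwa [hDev] at h1, h2, h3⟩
  have hDc0 : Dc ≠ 0 := by
    intro h0
    have := (hR (-(max Bq Bρ + 1) - 1) (by linarith)).1
    rw [h0, Polynomial.eval_zero] at this
    exact this rfl
  have hQr0 : Qr ≠ 0 := by
    intro h0
    have := (hR (-(max Bq Bρ + 1) - 1) (by linarith)).2.2
    rw [h0, Polynomial.eval_zero] at this
    exact this rfl
  refine ⟨P' * (Qr.comp (X + 1) * Qr) - (Pr.comp (X + 1) * Qr - Pr * Qr.comp (X + 1)) * Dc,
    Dc * (Qr.comp (X + 1) * Qr),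
    mul_ne_zero hDc0 (mul_ne_zero (anCore_comp_X_add_one_ne_zero hQr0) hQr0), max Bq Bρ + 1, ?_, ?_⟩
  · intro t ht
    obtain ⟨h1, h2, h3⟩ := hR t ht
    simp only [Polynomial.eval_mul, Polynomial.eval_comp, Polynomial.eval_add, Polynomial.eval_X,
      Polynomial.eval_one]
    exact mul_ne_zero h1 (mul_ne_zero h2 h3)
  · filter_upwards [hT] with t ht hRt
    obtain ⟨h1, h2, h3⟩ := hR t hRt
    have hm1 := le_max_left Bq Bρ
    have hm2 := le_max_right Bq Bρ
    have hqt := (hq t (by linarith)).2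
    have hρt := (hρ t (by linarith)).2
    have hρt1 := (hρ (t + 1) (by linarith)).2
    push_cast at hρt1
    rw [hDev] at hqt
    have : (f (t + 1) - ρ (t + 1)) - (f t - ρ t) = q t - (ρ (t + 1) - ρ t) := by rw [← ht]; ring
    rw [this, hqt, hρt, hρt1]
    simp only [Polynomial.eval_mul, Polynomial.eval_sub, Polynomial.eval_comp, Polynomial.eval_add,
      Polynomial.eval_X, Polynomial.eval_one]
    field_simp

end Summit.Langlands.Langlands.Theorems
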